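import Mathlib

/-!
# The equivariance step (E5-a)(i) of the period closer (T3.1 §4.5, seat t3-p1)

PERIOD.md §4.5 (E5-a)(i) [CELL]: for `f ∈ τ` whose archimedean component has `T_v`-weight `λ`
and a datum `ϕ_v` of `T_v`-weight `μ(v)`, the change of variables `g ↦ g t_v` in the theta lift
`θ(f̄, ϕ) = ∫_{[U(W)]} conj(f(g)) Θ(g, h; ϕ) dg` gives `θ(f̄, ϕ) = conj(λ(t_v)) μ(t_v) θ(f̄, ϕ)`, so
`θ(f̄, ϕ) = 0` unless `λ = μ(v)`.  This is what forces the corner weights to equal the data weights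
at every real place (TIER3.md §3 R-D′, «(E5-a) AUTOMATIC»), once Lemma W says the wedge is not
zero.

This file records the step with its exact hypotheses: a group `G` with a right-invariant measure
`μ` (the Haar measure of the compact group `[U(W)]`), an integrable `F : G → E` into a normed
`𝕜`-space (`F = conj(f) · Θ(·, h; ϕ)`), and the equivariance `F (g * t) = c • F g` for a scalar
`c` (`= conj(λ(t)) μ(t)`).  Then

* `eq_zero_of_eq_smul_self`: a vector with `v = c • v` and `c ≠ 1` is zero;
* `integral_eq_smul_integral_of_equivariant`: `∫ F = c • ∫ F` (change of variables);
* `integral_eq_zero_of_equivariant`: hence `∫ F = 0` when `c ≠ 1`;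
* `integral_eq_zero_of_weight_ne`: with `c = conj(λ t) * μ' t` for unitary weights `λ`, `μ'`
  (`‖λ t‖ = 1`), `∫ F = 0` as soon as `λ t ≠ μ' t` for one `t`;
* `weight_eq_of_integral_ne_zero`: the contrapositive used in §4.5 — a non-zero lift forces
  `λ = μ'` pointwise.

The file declares no definition and no notation; nothing here asserts anything about the Hodge
conjecture, which is NOT proved by anyone in this repository.
-/

namespace HodgeRepro.T3P1.WeightEquivariance

open MeasureTheory

variable {𝕜 : Type*} [RCLike 𝕜]
variable {E : Type*} [NormedAddCommGroup E] [NormedSpace ℝ E] [NormedSpace 𝕜 E]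

omit [NormedSpace ℝ E] in
/-- A vector fixed by a scalar `c ≠ 1` is zero. -/
theorem eq_zero_of_eq_smul_self {c : 𝕜} (hc : c ≠ 1) {v : E} (hv : v = c • v) : v = 0 := by
  have h : (1 - c) • v = 0 := by rw [sub_smul, one_smul, ← hv, sub_self]
  rcases smul_eq_zero.mp h with h1 | h1
  · exact absurd (sub_eq_zero.mp h1).symm hc
  · exact h1

variable {G : Type*} [Group G] [MeasurableSpace G] [MeasurableMul G]
variable {μ : Measure G} [μ.IsMulRightInvariant]

/-- CHANGE OF VARIABLES. If `F (g * t) = c • F g` for all `g`, then `∫ F dμ = c • ∫ F dμ` for a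
right-invariant `μ`. -/
theorem integral_eq_smul_integral_of_equivariant {F : G → E} (t : G) {c : 𝕜}
    (hF : ∀ g, F (g * t) = c • F g) :
    ∫ g, F g ∂μ = c • ∫ g, F g ∂μ := by
  calc ∫ g, F g ∂μ = ∫ g, F (g * t) ∂μ := (integral_mul_right_eq_self F t).symm
    _ = ∫ g, c • F g ∂μ := by simp only [hF]
    _ = c • ∫ g, F g ∂μ := integral_smul c F

/-- THE EQUIVARIANCE STEP. If `F (g * t) = c • F g` for all `g` with `c ≠ 1`, the integral of `F`
over a right-invariant measure vanishes. -/
theorem integral_eq_zero_of_equivariant {F : G → E} (t : G) {c : 𝕜} (hc : c ≠ 1)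
    (hF : ∀ g, F (g * t) = c • F g) :
    ∫ g, F g ∂μ = 0 :=
  eq_zero_of_eq_smul_self hc (integral_eq_smul_integral_of_equivariant t hF)

/-- For a unitary scalar `a` (`‖a‖ = 1`), `conj a * b = 1` forces `b = a`. -/
theorem eq_of_conj_mul_eq_one {a b : 𝕜} (ha : ‖a‖ = 1) (h : (starRingEnd 𝕜) a * b = 1) :
    b = a := by
  have hmc : a * (starRingEnd 𝕜) a = 1 := by
    rw [RCLike.mul_conj, ha]
    simp
  calc b = (a * (starRingEnd 𝕜) a) * b := by rw [hmc, one_mul]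
    _ = a * ((starRingEnd 𝕜) a * b) := by ring
    _ = a := by rw [h, mul_one]

/-- (E5-a)(i). With `F (g * t) = (conj (λ t) * μ' t) • F g` for all `g, t` — `f` of `T`-weight
`λ`, the datum of `T`-weight `μ'`, both unitary — the lift `∫ F` vanishes as soon as the two
weights differ at one `t`. -/
theorem integral_eq_zero_of_weight_ne {F : G → E} {lam mu' : G → 𝕜} (hlam : ∀ t, ‖lam t‖ = 1)
    (hF : ∀ g t, F (g * t) = ((starRingEnd 𝕜) (lam t) * mu' t) • F g)
    (hne : ∃ t, lam t ≠ mu' t) :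
    ∫ g, F g ∂μ = 0 := by
  obtain ⟨t, ht⟩ := hne
  refine integral_eq_zero_of_equivariant t ?_ (fun g => hF g t)
  intro h1
  exact ht (eq_of_conj_mul_eq_one (hlam t) h1).symm

/-- The contrapositive used in §4.5: a NON-ZERO lift forces the corner weight to equal the data
weight at every `t`. -/
theorem weight_eq_of_integral_ne_zero {F : G → E} {lam mu' : G → 𝕜} (hlam : ∀ t, ‖lam t‖ = 1)
    (hF : ∀ g t, F (g * t) = ((starRingEnd 𝕜) (lam t) * mu' t) • F g)
    (hne : ∫ g, F g ∂μ ≠ 0) : ∀ t, lam t = mu' t := by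
  intro t
  by_contra h
  exact hne (integral_eq_zero_of_weight_ne hlam hF ⟨t, h⟩)

end HodgeRepro.T3P1.WeightEquivariance
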